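import Summits.NavierStokesRegularity.NavierStokesRegularity.Theorems.LerayQuarterDissipationRecurrentReductionDStage2A
import Summits.NavierStokesRegularity.NavierStokesRegularity.Theorems.LerayQuarterDissipationRecurrentReductionDStage2B
import HarnessLib

/-!
# Route `LerayQuarterDissipation`, item `RecurrentReductionD` (stmt-NavierStokesRegularity-22507):
# sup-norm ε-regularity for `𝒟`, Stage 2 — the induction over nested parabolic regions

Helper file (theorems only, `--supports` the item). With `R = 4`, regions
`Ω_n = {‖y‖ < R_n + M√(−τ)}`, `R_n = 2 + 2q_n`, `q_n = 2^{−n}`, Type-I-small levels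
`η_n = η q_n³` and shell majorants `Λ_n = 16ηC₀c₃k₆(1 − q_n)`, `stage2_bounded` proves by
induction `(A_n)` `‖v‖ ≤ a + η_n(−τ)^{−1/2}` on `Ω_n` and `(B_n)` "the slice of the Duhamel
influence of the shell `Ω₀ ∖ Ω_n` on `{|v|>2a}` at points of `Ω_{n+1}` is `≤ Λ_n(−τ)^{−3/4}`",
using `stage2_stepA` for `(A_{n+1})` and the ring estimate `stage2_ring_slice` (the ring
`Ω_n ∖ Ω_{n+1}` at distance `≥ q_{n+1}` costs `2η_nC₀c₃q_{n+1}^{−3/2}k₆(−τ)^{−3/4} ≤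
8ηC₀c₃k₆q_n(−τ)^{−3/4}`) for `(B_{n+1})`; letting `n → ∞` gives `‖v‖ ≤ a` on `(t₁,0) × B(0,2)`.

References: G. Koch, N. Nadirashvili, G. Seregin, V. Šverák, arXiv:0709.3599, §4
[KochNadirashviliSereginSverak2009].
-/

noncomputable section

-- the summit and its single problem share the name (D-0017 nested layout)
set_option linter.dupNamespace false

namespace Summit.NavierStokesRegularity.NavierStokesRegularity.Theorems.RecurrentReductionD

open MeasureTheory Set Function Filter Topology Metric
open Literature.Analysis Literature.Analysis.FluidPDE Literature.Analysis.UnboundedOperators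
open scoped ENNReal NNReal

/-- **Ring estimate, slice form**: the Duhamel influence at time `τ` of the ring
`{Rn1 + M√(−τ) ≤ ‖y‖ < Rn + M√(−τ)}` restricted to `{|v| > 2a}`, seen from `x` with
`‖x‖ < Rn2 + M√(−t)`, `Rn2 + D ≤ Rn1`, given `‖v‖ ≤ a + η_n(−τ)^{−1/2}` on the region of radius
`Rn`, is at most `2η_n C₀ c₃ D^{−3/2} k₆ (−τ)^{−3/4}` (`c₃ = (3|B₁|·5/9)^{5/6}`).
[cite: KochNadirashviliSereginSverak2009, §4 p. 8 (arXiv:0709.3599)] -/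
theorem stage2_ring_slice {C₀ : ℝ} (hC₀ : 0 < C₀)
    {C : ℝ} {v : ℝ → EuclideanSpace ℝ (Fin 3) → EuclideanSpace ℝ (Fin 3)}
    (hv : IsTypeIAncientMild C v) {k₆ : ℝ} (hk₆ : 0 ≤ k₆)
    (hL6 : ∀ τ : ℝ, τ < 0 → eLpNorm (v τ) 6 volume ≤ ENNReal.ofReal (k₆ * (-τ) ^ (-(1 / 4 : ℝ))))
    {t₁ t Rn Rn1 Rn2 D M a ηn : ℝ} (ht : t < 0) (hD : 0 < D) (hM : 0 < M)
    (hηn : 0 ≤ ηn) (hD1 : Rn2 + D ≤ Rn1)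
    (hAn : ∀ τ ∈ Ioo t₁ 0, ∀ y : EuclideanSpace ℝ (Fin 3),
      ‖y‖ < Rn + M * Real.sqrt (-τ) → ‖v τ y‖ ≤ a + ηn * (-τ) ^ (-(1 / 2 : ℝ)))
    {x : EuclideanSpace ℝ (Fin 3)} (hx : ‖x‖ < Rn2 + M * Real.sqrt (-t)) {τ : ℝ} (hτ : τ ∈ Ioo t₁ t) :
    ∫⁻ y in ball (0 : EuclideanSpace ℝ (Fin 3)) (Rn + M * Real.sqrt (-τ)) \ ball 0 (Rn1 + M * Real.sqrt (-τ)),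
        ENNReal.ofReal (C₀ * ((t - τ) + ‖x - y‖ ^ 2) ^ (-(2 : ℝ))) *
          indicator {z : EuclideanSpace ℝ (Fin 3) | 2 * a < ‖z‖} (fun z => ‖z‖ₑ ^ 2) (v τ y) ≤
      ENNReal.ofReal ((2 * ηn * C₀ * (3 * (volume : Measure (EuclideanSpace ℝ (Fin 3))).real (ball 0 1) *
        (5 / 9)) ^ (5 / 6 : ℝ) * D ^ (-(3 / 2 : ℝ)) * k₆) * (-τ) ^ (-(3 / 4 : ℝ))) := by
  set c₃ : ℝ := (3 * (volume : Measure (EuclideanSpace ℝ (Fin 3))).real (ball 0 1) * (5 / 9)) ^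
    (5 / 6 : ℝ) with hc₃
  have hc₃0 : 0 ≤ c₃ := by positivity
  have hnt : 0 < -t := neg_pos.2 ht
  have hτt : τ < t := hτ.2
  have hτ0 : τ < 0 := hτt.trans ht
  have hnτ : 0 < -τ := neg_pos.2 hτ0
  have hσ : 0 < t - τ := sub_pos.2 hτt
  set Ring : Set (EuclideanSpace ℝ (Fin 3)) :=
    ball (0 : EuclideanSpace ℝ (Fin 3)) (Rn + M * Real.sqrt (-τ)) \ ball 0 (Rn1 + M * Real.sqrt (-τ))
    with hRing
  -- on the ring: excess ≤ 2ηn(−τ)^{−1/2}‖v‖, and separation `≥ D`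
  have hb : ∀ y ∈ Ring, indicator {z : EuclideanSpace ℝ (Fin 3) | 2 * a < ‖z‖} (fun z => ‖z‖ₑ ^ 2) (v τ y) ≤
      ENNReal.ofReal (2 * ηn * (-τ) ^ (-(1 / 2 : ℝ))) * ‖v τ y‖ₑ := by
    intro y hy
    have hy' : ‖y‖ < Rn + M * Real.sqrt (-τ) := by
      have := hy.1; rwa [mem_ball_zero_iff] at this
    exact excess_le_mul_of_bound hηn hτ0 (hAn τ ⟨hτ.1, hτ0⟩ y hy')
  have hsub : Ring ⊆ (ball x D)ᶜ := by
    intro y hy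
    have hy2 : Rn1 + M * Real.sqrt (-τ) ≤ ‖y‖ := by
      have := hy.2; rwa [mem_ball_zero_iff, not_lt] at this
    rw [mem_compl_iff, mem_ball, not_lt, dist_eq_norm]
    have hst : Real.sqrt (-t) ≤ Real.sqrt (-τ) := Real.sqrt_le_sqrt (by linarith)
    nlinarith [norm_sub_norm_le y x, hM.le]
  have hL := lintegral_env_mul_enorm_le hσ hD x (hv.aestronglyMeasurable_slice hτ0)
  have hL6' := hL6 τ hτ0
  calc ∫⁻ y in Ring, ENNReal.ofReal (C₀ * ((t - τ) + ‖x - y‖ ^ 2) ^ (-(2 : ℝ))) *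
          indicator {z : EuclideanSpace ℝ (Fin 3) | 2 * a < ‖z‖} (fun z => ‖z‖ₑ ^ 2) (v τ y)
      ≤ ∫⁻ y in Ring, ENNReal.ofReal (C₀ * ((t - τ) + ‖x - y‖ ^ 2) ^ (-(2 : ℝ))) *
          (ENNReal.ofReal (2 * ηn * (-τ) ^ (-(1 / 2 : ℝ))) * ‖v τ y‖ₑ) :=
        setLIntegral_mono' (measurableSet_ball.diff measurableSet_ball) fun y hy =>
          mul_le_mul' le_rfl (hb y hy)
    _ ≤ ∫⁻ y in (ball x D)ᶜ, ENNReal.ofReal (C₀ * ((t - τ) + ‖x - y‖ ^ 2) ^ (-(2 : ℝ))) *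
          (ENNReal.ofReal (2 * ηn * (-τ) ^ (-(1 / 2 : ℝ))) * ‖v τ y‖ₑ) := lintegral_mono_set hsub
    _ = ENNReal.ofReal C₀ * ENNReal.ofReal (2 * ηn * (-τ) ^ (-(1 / 2 : ℝ))) *
          ∫⁻ y in (ball x D)ᶜ, ENNReal.ofReal (((t - τ) + ‖x - y‖ ^ 2) ^ (-(2 : ℝ))) * ‖v τ y‖ₑ := by
        rw [← lintegral_const_mul' _ _ (ENNReal.mul_ne_top ENNReal.ofReal_ne_top ENNReal.ofReal_ne_top)]
        refine lintegral_congr fun y => ?_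
        rw [ENNReal.ofReal_mul hC₀.le]; ring
    _ ≤ ENNReal.ofReal C₀ * ENNReal.ofReal (2 * ηn * (-τ) ^ (-(1 / 2 : ℝ))) *
          (ENNReal.ofReal (c₃ * D ^ (-(3 / 2 : ℝ))) * eLpNorm (v τ) 6 volume) := by
        gcongr
    _ ≤ ENNReal.ofReal C₀ * ENNReal.ofReal (2 * ηn * (-τ) ^ (-(1 / 2 : ℝ))) *
          (ENNReal.ofReal (c₃ * D ^ (-(3 / 2 : ℝ))) * ENNReal.ofReal (k₆ * (-τ) ^ (-(1 / 4 : ℝ)))) := by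
        gcongr
    _ = _ := by
        have hp1 : 0 ≤ 2 * ηn * (-τ) ^ (-(1 / 2 : ℝ)) := by
          have := Real.rpow_nonneg hnτ.le (-(1 / 2 : ℝ)); positivity
        have hp2 : 0 ≤ c₃ * D ^ (-(3 / 2 : ℝ)) := by
          have := Real.rpow_nonneg hD.le (-(3 / 2 : ℝ)); positivity
        have hp3 : 0 ≤ k₆ * (-τ) ^ (-(1 / 4 : ℝ)) := by
          have := Real.rpow_nonneg hnτ.le (-(1 / 4 : ℝ)); positivity
        rw [← ENNReal.ofReal_mul hp2, ← ENNReal.ofReal_mul hC₀.le, ← ENNReal.ofReal_mul (mul_nonneg hC₀.le hp1)]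
        congr 1
        have e : (-τ) ^ (-(1 / 2 : ℝ)) * (-τ) ^ (-(1 / 4 : ℝ)) = (-τ) ^ (-(3 / 4 : ℝ)) := by
          rw [← Real.rpow_add hnτ]; norm_num
        calc C₀ * (2 * ηn * (-τ) ^ (-(1 / 2 : ℝ))) * (c₃ * D ^ (-(3 / 2 : ℝ)) * (k₆ * (-τ) ^ (-(1 / 4 : ℝ))))
            = 2 * ηn * C₀ * c₃ * D ^ (-(3 / 2 : ℝ)) * k₆ * ((-τ) ^ (-(1 / 2 : ℝ)) * (-τ) ^ (-(1 / 4 : ℝ))) := by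
              ring
          _ = _ := by rw [e]

/-- **Stage 2 of the ε-regularity bootstrap** (module docstring): with `R = 4`, a Type-I
ancient mild field with `L⁶` slices `‖v(τ)‖₆ ≤ k₆(−τ)^{−1/4}`, Type-I-small on the parabolic
region `{‖y‖ < 4 + M√(−τ)}` (`‖v‖ ≤ a + η(−τ)^{−1/2}`) and with heat term `≤ a/4` there, is
bounded by `a` on `(t₁, 0) × B(0, 2)`, under the stated numerical constraints
(`κ₁ = C₀I₂`, `c₃ = (3|B₁|·5/9)^{5/6}`, `c₄ = (3|B₁|/3)^{2/3}`).
[cite: KochNadirashviliSereginSverak2009, §4 p. 8 (arXiv:0709.3599)] -/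
theorem stage2_bounded {C₀ : ℝ} (hC₀ : 0 < C₀)
    (hK : ∀ ⦃σ : ℝ⦄, 0 < σ → ∀ z a b : EuclideanSpace ℝ (Fin 3),
      ‖oseenKernel σ z a b‖ ≤ C₀ * (σ + ‖z‖ ^ 2) ^ (-(2 : ℝ)) * ‖a‖ * ‖b‖)
    {C : ℝ} {v : ℝ → EuclideanSpace ℝ (Fin 3) → EuclideanSpace ℝ (Fin 3)}
    (hv : IsTypeIAncientMild C v) {k₆ : ℝ} (hk₆ : 0 ≤ k₆)
    (hL6 : ∀ τ : ℝ, τ < 0 → eLpNorm (v τ) 6 volume ≤ ENNReal.ofReal (k₆ * (-τ) ^ (-(1 / 4 : ℝ))))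
    {t₁ M a η : ℝ} (ht₁ : t₁ < 0) (hM : 0 < M) (ha : 0 < a) (hη : 0 ≤ η)
    (hA0 : ∀ τ ∈ Ioo t₁ 0, ∀ y : EuclideanSpace ℝ (Fin 3),
      ‖y‖ < 4 + M * Real.sqrt (-τ) → ‖v τ y‖ ≤ a + η * (-τ) ^ (-(1 / 2 : ℝ)))
    (hheat : ∀ t ∈ Ioo t₁ 0, ∀ x : EuclideanSpace ℝ (Fin 3),
      ‖x‖ < 4 + M * Real.sqrt (-t) → ‖heatExtension (v t₁) (t - t₁) x‖ ≤ a / 4)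
    (c_a : 32 * (C₀ * ∫ w : EuclideanSpace ℝ (Fin 3), (1 + ‖w‖ ^ 2) ^ (-(2 : ℝ))) * a *
      Real.sqrt (-t₁) ≤ 1)
    (c_η : 128 * (C₀ * ∫ w : EuclideanSpace ℝ (Fin 3), (1 + ‖w‖ ^ 2) ^ (-(2 : ℝ))) * η ≤ 1)
    (c_ring : 256 * η * (C₀ * (3 * (volume : Measure (EuclideanSpace ℝ (Fin 3))).real (ball 0 1) *
        (5 / 9)) ^ (5 / 6 : ℝ)) * k₆ * (-t₁) ^ (1 / 4 : ℝ) ≤ a)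
    (c_ext : 32 * (C₀ * (3 * (volume : Measure (EuclideanSpace ℝ (Fin 3))).real (ball 0 1) * (1 / 3)) ^
        (2 / 3 : ℝ)) * (4 : ℝ) ^ (-(2 : ℝ)) * k₆ ^ 2 * Real.sqrt (-t₁) ≤ a / 4) :
    ∀ t ∈ Ioo t₁ 0, ∀ x : EuclideanSpace ℝ (Fin 3), ‖x‖ < 2 → ‖v t x‖ ≤ a := by
  -- ## constants and sequences
  obtain ⟨κ₁, hκ₁⟩ : ∃ κ₁ : ℝ, κ₁ = C₀ * ∫ w : EuclideanSpace ℝ (Fin 3), (1 + ‖w‖ ^ 2) ^ (-(2 : ℝ)) :=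
    ⟨_, rfl⟩
  obtain ⟨c₃, hc₃⟩ : ∃ c₃ : ℝ, c₃ = (3 * (volume : Measure (EuclideanSpace ℝ (Fin 3))).real (ball 0 1) *
    (5 / 9)) ^ (5 / 6 : ℝ) := ⟨_, rfl⟩
  rw [← hκ₁] at c_η
  rw [← hc₃] at c_ring
  have hI₂pos : 0 < ∫ w : EuclideanSpace ℝ (Fin 3), (1 + ‖w‖ ^ 2) ^ (-(2 : ℝ)) :=
    integral_one_add_norm_sq_rpow_neg_pos (E := EuclideanSpace ℝ (Fin 3))
      (by rw [finrank_euclideanSpace_fin]; norm_num)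
  have hκ₁pos : 0 < κ₁ := by rw [hκ₁]; exact mul_pos hC₀ hI₂pos
  have hc₃0 : 0 ≤ c₃ := by rw [hc₃]; positivity
  have hnt₁ : 0 < -t₁ := neg_pos.2 ht₁
  -- `q n = 2^{-n}`, radii `2 + 2 q n`, levels `η (q n)^3`, shell majorants `Λ n`
  set q : ℕ → ℝ := fun n => (1 / 2 : ℝ) ^ n with hq
  have hq0 : ∀ n, 0 < q n := fun n => by simp only [hq]; positivity
  have hq1 : ∀ n, q n ≤ 1 := fun n => by simp only [hq]; exact pow_le_one₀ (by norm_num) (by norm_num)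
  have hqs : ∀ n, q (n + 1) = q n / 2 := fun n => by simp only [hq, pow_succ]; ring
  set Rr : ℕ → ℝ := fun n => 2 + 2 * q n with hRr
  set ηs : ℕ → ℝ := fun n => η * q n ^ 3 with hηs
  set Λ : ℕ → ℝ := fun n => 16 * η * C₀ * c₃ * k₆ * (1 - q n) with hΛ
  have hηs0 : ∀ n, 0 ≤ ηs n := fun n => by simp only [hηs]; positivity
  have hηsle : ∀ n, ηs n ≤ η := fun n => by
    simp only [hηs]
    have : q n ^ 3 ≤ 1 := pow_le_one₀ (hq0 n).le (hq1 n)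
    nlinarith
  have hΛ0 : ∀ n, 0 ≤ Λ n := fun n => by
    simp only [hΛ]; have := hq1 n; have := mul_nonneg (mul_nonneg (mul_nonneg hη hC₀.le) hc₃0) hk₆
    nlinarith
  have hΛle : ∀ n, Λ n ≤ 16 * η * C₀ * c₃ * k₆ := fun n => by
    simp only [hΛ]; have := hq0 n; have := mul_nonneg (mul_nonneg (mul_nonneg hη hC₀.le) hc₃0) hk₆
    nlinarith
  -- ## the induction
  have key : ∀ n : ℕ,
      (∀ t ∈ Ioo t₁ 0, ∀ y : EuclideanSpace ℝ (Fin 3),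
        ‖y‖ < Rr n + M * Real.sqrt (-t) → ‖v t y‖ ≤ a + ηs n * (-t) ^ (-(1 / 2 : ℝ))) ∧
      (∀ t ∈ Ioo t₁ 0, ∀ x : EuclideanSpace ℝ (Fin 3), ‖x‖ < Rr (n + 1) + M * Real.sqrt (-t) →
        ∀ τ ∈ Ioo t₁ t,
          ∫⁻ y in ball (0 : EuclideanSpace ℝ (Fin 3)) (4 + M * Real.sqrt (-τ)) \
              ball 0 (Rr n + M * Real.sqrt (-τ)),
            ENNReal.ofReal (C₀ * ((t - τ) + ‖x - y‖ ^ 2) ^ (-(2 : ℝ))) *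
              indicator {z : EuclideanSpace ℝ (Fin 3) | 2 * a < ‖z‖} (fun z => ‖z‖ₑ ^ 2) (v τ y) ≤
          ENNReal.ofReal (Λ n * (-τ) ^ (-(3 / 4 : ℝ)))) := by
    intro n
    induction n with
    | zero =>
      have hR0 : Rr 0 = 4 := by simp only [hRr, hq]; norm_num
      have hη0 : ηs 0 = η := by simp only [hηs, hq]; norm_num
      refine ⟨?_, ?_⟩
      · rw [hR0, hη0]; exact hA0
      · intro t ht x hx τ hτ
        rw [hR0, _root_.sdiff_self, Set.bot_eq_empty, Measure.restrict_empty, lintegral_zero_measure]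
        exact bot_le
    | succ n ih =>
      obtain ⟨hA, hB⟩ := ih
      have hRn1 : Rr (n + 1) ≤ 3 := by
        simp only [hRr]; rw [hqs]; have := hq1 n; linarith
      have hRmono : Rr (n + 1) ≤ Rr n := by
        simp only [hRr]; rw [hqs]; have := hq0 n; linarith
      -- (A_{n+1})
      have hA' : ∀ t ∈ Ioo t₁ 0, ∀ y : EuclideanSpace ℝ (Fin 3),
          ‖y‖ < Rr (n + 1) + M * Real.sqrt (-t) → ‖v t y‖ ≤ a + ηs (n + 1) * (-t) ^ (-(1 / 2 : ℝ)) := by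
        intro t ht x hx
        set S : ℝ := Λ n * ((-t₁) ^ (1 / 4 : ℝ) * 4) with hS
        have hS0 : 0 ≤ S := by rw [hS]; have := hΛ0 n; positivity
        have hBn : ∫⁻ τ in Ioo t₁ t, ∫⁻ y in ball (0 : EuclideanSpace ℝ (Fin 3)) (4 + M * Real.sqrt (-τ)) \
              ball 0 (Rr n + M * Real.sqrt (-τ)),
            ENNReal.ofReal (C₀ * ((t - τ) + ‖x - y‖ ^ 2) ^ (-(2 : ℝ))) *
              indicator {z : EuclideanSpace ℝ (Fin 3) | 2 * a < ‖z‖} (fun z => ‖z‖ₑ ^ 2) (v τ y) ≤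
            ENNReal.ofReal S := by
          refine (setLIntegral_mono' measurableSet_Ioo (hB t ht x hx)).trans ?_
          have e : ∀ τ, ENNReal.ofReal (Λ n * (-τ) ^ (-(3 / 4 : ℝ))) =
              ENNReal.ofReal (Λ n) * ENNReal.ofReal ((-τ) ^ (-(3 / 4 : ℝ))) :=
            fun τ => ENNReal.ofReal_mul (hΛ0 n)
          simp_rw [e]
          rw [lintegral_const_mul' _ _ ENNReal.ofReal_ne_top, hS, ENNReal.ofReal_mul (hΛ0 n)]
          gcongr
          refine (lintegral_Ioo_neg_rpow_le (by norm_num) ht.1 ht.2.le).trans (le_of_eq ?_)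
          congr 1
          rw [show (1 : ℝ) - 3 / 4 = 1 / 4 by norm_num]
          ring
        have hc_η : 16 * (C₀ * ∫ w : EuclideanSpace ℝ (Fin 3), (1 + ‖w‖ ^ 2) ^ (-(2 : ℝ))) *
            ηs n ^ 2 ≤ ηs (n + 1) := by
          rw [← hκ₁]
          have e1 : ηs (n + 1) = ηs n / 8 := by simp only [hηs]; rw [hqs]; ring
          rw [e1]
          have h1 : 128 * κ₁ * ηs n ≤ 1 := by
            have := mul_le_mul_of_nonneg_left (hηsle n) (by positivity : (0 : ℝ) ≤ 128 * κ₁)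
            linarith
          have h2 : 0 ≤ ηs n := hηs0 n
          nlinarith [mul_le_mul_of_nonneg_left h1 h2]
        have hR4 : Rr n ≤ 4 := by simp only [hRr]; have := hq1 n; linarith
        have hxR : ‖x‖ < 4 + M * Real.sqrt (-t) := by linarith
        have h := stage2_stepA hC₀ hK hv hk₆ hL6 (R := 4) ht.1 ht.2 (by norm_num) hM ha hS0
          (by linarith) hA hx hBn (hheat t ht x hxR) c_a hc_η c_ext
        have hS1 : S ≤ a / 4 := by
          rw [hS]
          have := hΛle n
          have hp : 0 ≤ (-t₁) ^ (1 / 4 : ℝ) := Real.rpow_nonneg hnt₁.le _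
          calc Λ n * ((-t₁) ^ (1 / 4 : ℝ) * 4) ≤ (16 * η * C₀ * c₃ * k₆) * ((-t₁) ^ (1 / 4 : ℝ) * 4) :=
                mul_le_mul_of_nonneg_right this (by positivity)
            _ = (256 * η * (C₀ * c₃) * k₆ * (-t₁) ^ (1 / 4 : ℝ)) / 4 := by ring
            _ ≤ a / 4 := by gcongr
        linarith
      refine ⟨hA', ?_⟩
      -- (B_{n+1})
      intro t ht x hx τ hτ
      have hτ0 : τ < 0 := hτ.2.trans ht.2
      have hnτ : 0 < -τ := neg_pos.2 hτ0
      set S0 : Set (EuclideanSpace ℝ (Fin 3)) := ball 0 (4 + M * Real.sqrt (-τ)) with hS0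
      set Sn : Set (EuclideanSpace ℝ (Fin 3)) := ball 0 (Rr n + M * Real.sqrt (-τ)) with hSn
      set Sn1 : Set (EuclideanSpace ℝ (Fin 3)) := ball 0 (Rr (n + 1) + M * Real.sqrt (-τ)) with hSn1
      have hcover : S0 \ Sn1 ⊆ (S0 \ Sn) ∪ (Sn \ Sn1) := by
        intro y hy
        by_cases hyn : y ∈ Sn
        · exact Or.inr ⟨hyn, hy.2⟩
        · exact Or.inl ⟨hy.1, hyn⟩
      -- the old shell, seen from the smaller region
      have hx' : ‖x‖ < Rr (n + 1) + M * Real.sqrt (-t) := by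
        have : Rr (n + 2) ≤ Rr (n + 1) := by
          simp only [hRr]; rw [hqs (n + 1)]; have := hq0 (n + 1); linarith
        linarith
      have h1 := hB t ht x hx' τ hτ
      -- the new ring, at distance `q (n+1)`
      have hD1 : Rr (n + 2) + q (n + 1) ≤ Rr (n + 1) := by
        simp only [hRr]; rw [hqs (n + 1)]; linarith
      have h2 := stage2_ring_slice hC₀ hv hk₆ hL6 ht.2 (hq0 (n + 1)) hM (hηs0 n) hD1 hA hx hτ
      rw [← hc₃] at h2
      -- the ring coefficient: `2 ηs n C₀ c₃ q_{n+1}^{-3/2} k₆ ≤ 8 η C₀ c₃ k₆ q n`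
      have hcoef : 2 * ηs n * C₀ * c₃ * q (n + 1) ^ (-(3 / 2 : ℝ)) * k₆ ≤ 8 * η * C₀ * c₃ * k₆ * q n := by
        have hD0 := hq0 (n + 1)
        have hpow : q (n + 1) ^ (-(3 / 2 : ℝ)) ≤ q (n + 1) ^ (-(2 : ℝ)) :=
          Real.rpow_le_rpow_of_exponent_ge hD0 (hq1 (n + 1)) (by norm_num)
        have hpow2 : q (n + 1) ^ (-(2 : ℝ)) = (q (n + 1) ^ 2)⁻¹ := by
          rw [Real.rpow_neg hD0.le, show (2 : ℝ) = ((2 : ℕ) : ℝ) by norm_num, Real.rpow_natCast]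
        have hkey : ηs n * q (n + 1) ^ (-(2 : ℝ)) = 4 * η * q n := by
          rw [hpow2, hqs]; simp only [hηs]
          have := (hq0 n).ne'
          field_simp
          ring
        calc 2 * ηs n * C₀ * c₃ * q (n + 1) ^ (-(3 / 2 : ℝ)) * k₆
            = (2 * C₀ * c₃ * k₆) * (ηs n * q (n + 1) ^ (-(3 / 2 : ℝ))) := by ring
          _ ≤ (2 * C₀ * c₃ * k₆) * (ηs n * q (n + 1) ^ (-(2 : ℝ))) := by
              refine mul_le_mul_of_nonneg_left (mul_le_mul_of_nonneg_left hpow (hηs0 n)) ?_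
              positivity
          _ = 8 * η * C₀ * c₃ * k₆ * q n := by rw [hkey]; ring
      have hΛs : Λ n + 8 * η * C₀ * c₃ * k₆ * q n = Λ (n + 1) := by
        simp only [hΛ]; rw [hqs]; ring
      have hrpow : 0 ≤ (-τ) ^ (-(3 / 4 : ℝ)) := Real.rpow_nonneg hnτ.le _
      have h8 : 0 ≤ 8 * η * C₀ * c₃ * k₆ * q n := by have := hq0 n; positivity
      calc ∫⁻ y in S0 \ Sn1, ENNReal.ofReal (C₀ * ((t - τ) + ‖x - y‖ ^ 2) ^ (-(2 : ℝ))) *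
              indicator {z : EuclideanSpace ℝ (Fin 3) | 2 * a < ‖z‖} (fun z => ‖z‖ₑ ^ 2) (v τ y)
          ≤ ∫⁻ y in (S0 \ Sn) ∪ (Sn \ Sn1), ENNReal.ofReal (C₀ * ((t - τ) + ‖x - y‖ ^ 2) ^ (-(2 : ℝ))) *
              indicator {z : EuclideanSpace ℝ (Fin 3) | 2 * a < ‖z‖} (fun z => ‖z‖ₑ ^ 2) (v τ y) :=
            lintegral_mono_set hcover
        _ ≤ (∫⁻ y in S0 \ Sn, ENNReal.ofReal (C₀ * ((t - τ) + ‖x - y‖ ^ 2) ^ (-(2 : ℝ))) *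
              indicator {z : EuclideanSpace ℝ (Fin 3) | 2 * a < ‖z‖} (fun z => ‖z‖ₑ ^ 2) (v τ y)) +
            ∫⁻ y in Sn \ Sn1, ENNReal.ofReal (C₀ * ((t - τ) + ‖x - y‖ ^ 2) ^ (-(2 : ℝ))) *
              indicator {z : EuclideanSpace ℝ (Fin 3) | 2 * a < ‖z‖} (fun z => ‖z‖ₑ ^ 2) (v τ y) :=
            lintegral_union_le _ _ _
        _ ≤ ENNReal.ofReal (Λ n * (-τ) ^ (-(3 / 4 : ℝ))) +
            ENNReal.ofReal ((2 * ηs n * C₀ * c₃ * q (n + 1) ^ (-(3 / 2 : ℝ)) * k₆) * (-τ) ^ (-(3 / 4 : ℝ))) :=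
            add_le_add h1 h2
        _ ≤ ENNReal.ofReal (Λ n * (-τ) ^ (-(3 / 4 : ℝ))) +
            ENNReal.ofReal ((8 * η * C₀ * c₃ * k₆ * q n) * (-τ) ^ (-(3 / 4 : ℝ))) := by
            gcongr _ + ENNReal.ofReal ?_
            exact mul_le_mul_of_nonneg_right hcoef hrpow
        _ = ENNReal.ofReal (Λ (n + 1) * (-τ) ^ (-(3 / 4 : ℝ))) := by
            rw [← ENNReal.ofReal_add (mul_nonneg (hΛ0 n) hrpow) (mul_nonneg h8 hrpow), ← add_mul, hΛs]
  -- ## conclusion: let `n → ∞`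
  intro t ht x hx
  have hnt : 0 < -t := neg_pos.2 ht.2
  have hbound : ∀ n : ℕ, ‖v t x‖ ≤ a + η * q n ^ 3 * (-t) ^ (-(1 / 2 : ℝ)) := by
    intro n
    have hxn : ‖x‖ < Rr n + M * Real.sqrt (-t) := by
      have : 2 < Rr n + M * Real.sqrt (-t) := by
        simp only [hRr]; have := hq0 n; have := Real.sqrt_nonneg (-t); nlinarith
      linarith
    have := (key n).1 t ht x hxn
    simpa only [hηs] using this
  have hlim : Tendsto (fun n : ℕ => a + η * q n ^ 3 * (-t) ^ (-(1 / 2 : ℝ))) atTop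
      (𝓝 (a + η * 0 ^ 3 * (-t) ^ (-(1 / 2 : ℝ)))) := by
    have hq' : Tendsto q atTop (𝓝 0) := by
      simp only [hq]
      exact tendsto_pow_atTop_nhds_zero_of_lt_one (by norm_num) (by norm_num)
    exact tendsto_const_nhds.add ((tendsto_const_nhds.mul (hq'.pow 3)).mul tendsto_const_nhds)
  have := ge_of_tendsto' hlim hbound
  simpa using this

end Summit.NavierStokesRegularity.NavierStokesRegularity.Theorems.RecurrentReductionD

end
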